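import Literature.MathematicalPhysics.QuantumFieldTheory.Balaban1983to89.B9Thm312WholeFromThm310

/-!
# `Balaban1983to89.B9Thm312WholeFromThm310L2` — [B9] Theorems 3.12–3.13 (pp. 421–426): «THEOREM 3.3 FOR G₀» OF THE SECT.-D LEAVES IS
# THEOREM 3.10's SUM, THE L² MEMBERS (3.46) — the rows-20–21 schema `Thm33G0L2M` (and its parent `Thm33G0L2P`) PROVED from the
# Theorem-3.10 schemas of rows 18–19 through n06-k's operator-level theorems, the Schur test and p. 398's scale transfer

T. Bałaban, *Propagators for lattice gauge theories in a background field*, Commun. Math. Phys. **99** (1985) 389–434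
[`Balaban1985BackgroundPropagators`, "B9"]; [4] = T. Bałaban, *Propagators and renormalization transformations for lattice gauge
theories. II*, Commun. Math. Phys. **96** (1984) 223–250 [`Balaban1984PropagatorsII`].

statement-level skeleton of published theorems with citation tags; proofs where landed; nothing here is a claim about the Yang–Mills
mass gap

THE PRINTED LOCUS.  p. 398, (3.46) (the six L² lines of Theorem 3.1 ∕ 3.3) and the remark after (3.47): *"Using Lemma 2.1 in [4] we
may replace the factor (Lʲη)^α by (Lʲη)^β(L^{j′}η)^γ with β + γ = α"*, *"we may always replace ∇_U by ∇\*_U, and vice versa"*; p. 416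
(Theorem 3.10): *"the expansion (3.107) is convergent in all norms in the inequalities (3.42)–(3.47)"*; p. 421: G₀ = *"the operator we
have investigated in previous sections"*.

THE POINT (sequel of `…B9Thm312WholeFromThm310`, same letter identification G₀ := G(U)).  The rows-20–21 leaves read Theorem 3.3's L²
members for G₀ in r1-g6's weight classes (`B9Thm312WholeBlocksNbr.Thm33G0L2P`: lines 0, 1, 2, 4 one-slot with the printed one-sided powers
split as p. 398 allows — B·Lʲη·L^{j′}η, B·L^{j′}η, B·Lʲη, B; lines 3, 5 per direction pair with the dimensionless scale ratio; and
`B9Thm312WholeDir.Thm33G0L2M`'s per-direction lines `l1d l2d l4m`).  Every one of them follows from rows 18–19's material: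
* lines 0, 1, 2 and the per-direction `l1d ∕ l2d` by the SCHUR TEST (n06-k `B9RWSums346Schur.blockBd_schur`) from the (3.42) sup majorants of
  `Conv3107` (per direction through `DirSup310`), the symmetry of G(U) and the transposition letters (∇_UG)ᵀ = G∇\*_U, (∇_{U,ν})ᵀ = ∇\*_{U,ν}
  (`DirTranspose310`) — already displayed for rows 18–19 (`hsymA`, `htrA` are PROVED at def-Y's pins) — and p. 398's scale transfer
  (`Facts347`; n06-k's `blockBd_entry2` for the output-scale lines, its adjoint for the input-scale ones);
* lines 3, 5 by n06-k's `l2line3_of_local310 ∕ l2line5_of_local310` (second-difference legs `L2SecondLegs310`, factors `FactorsL2Second310`)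
  followed by one transfer at γ = ∓1 into the scale-ratio shapes;
* the mixed pair line `l4m` by n06-k's `l2mixed_of_local310` (`L2MixedLegs310`, `FactorsL2Mixed310`, `DirSup310`);
* the bundled two-sided line `l4` — a REQUIRED FIELD of the schema although the PAIR-M leaves discard it (`l2Block_of_step_pairM`) —
  EITHER by n06-k's `l2line4_of_local310` from n06-k's one-slot legs `B9RWSums346Two.L2TwoLegs310 ∕ FactorsL2_310` (EXISTING species,
  not displayed by the PairM certificate: `thm33G0L2M_of_conv3107`), OR passed through as ONE displayed line (`thm33G0L2M_of_conv3107_l4`).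
All at one common rate ρ ≦ (1 − 3α)δ (δ = the rate of `Conv3107`, α = the transfer exponent) and one constant B₂ dominating the five
line constants.

HONEST SCOPE.  Kernel bookkeeping over landed modules: NOTHING of print asserted, NO new hypothesis species (n06-k's displayed schemas,
member facts, letter equations only).  COUNT-NEUTRAL; N06 NOT discharged; one finite lattice at a time; nothing continuum, nothing about
the mass gap.  Cell `pub-ymgap` (HUMAN RULING D-0062), Track A node N06 [B9], N06-ASSIGNMENT v1 rows 20–21 (bundle F7), seat
`pub-ymgap-dag-n06-l` (g10), 2026-08-27.
-/

namespace Literature.MathematicalPhysics.QuantumFieldTheory.Balaban1983to89.B9Thm312WholeFromThm310L2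

open Literature.MathematicalPhysics.QuantumFieldTheory.Balaban1983to89
open Finset B6RandomWalk B6RandomWalkHom B9Thm34Ext B11SectG B9Thm37Glue B9SectDL2Decay B9Ineq347
open B9Thm312Whole B9Thm312WholeLeft B9Thm312WholeClasses B9Thm312WholeBlocksNbr B9Thm312WholeDir B9Thm313WholeDir
open B9Thm310Whole B9RWSums343Holder B9RWSums343to347Whole B9RWSums346Schur B9RWSums346Two B9RWSums346MixedPair
open B9RWSums346SecondDiff B9Thm312WholeFromThm310

noncomputable section

variable {g : B9.Geometry} {B : B9.Backgrounds} {X Y Z W ι A P : Type} [Fintype g.Site]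
variable {R : ℝ} {H : Prop}

/-! ## §0 Scale-transfer arithmetic ([4] Lemma 2.1 (2.60) via `Facts347`) -/

/-- L^{|γ|} ≦ L₀ for |γ| ≦ 1 under the member facts 1 ≦ L ≦ L₀ (n06-k's private `rpow_abs_le_L₀`). [folklore] -/
private theorem rpow_abs_le_L₀' {d : ℕ} {δ α L₀ : ℝ} (hF : Facts347 g R H d δ α L₀) (γ : ℝ) (hγ : |γ| ≤ 1) : g.L ^ |γ| ≤ L₀ :=
  calc g.L ^ |γ| ≤ g.L ^ (1 : ℝ) := Real.rpow_le_rpow_of_exponent_le hF.one_le_L hγ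
    _ = g.L := Real.rpow_one _
    _ ≤ L₀ := hF.L_le

/-- **The transfer at γ = 1, direct pair**: e^{−αδd(y,y′)}·L^{j′}η ≦ L₀·Lʲη, hence for S ≧ 0 and any rate r:
S·e^{−rd(y,y′)} ≦ S·L₀·(Lʲη·(L^{j′}η)⁻¹)·e^{−(r − αδ)d(y,y′)}. [cite: Balaban1985BackgroundPropagators, p.398 remark after (3.47); Balaban1984PropagatorsII, Lemma 2.1 (2.60) p.234] -/
theorem const_le_ratio_transfer {d : ℕ} {δ α L₀ : ℝ} (hF : Facts347 g R H d δ α L₀) (hlen : ∀ y : g.Site, 0 < g.len y)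
    {S r : ℝ} (hS : 0 ≤ S) (y y' : g.Site) :
    S * Real.exp (-(r * g.dist y y')) ≤
      S * L₀ * (g.len y * (g.len y')⁻¹) * Real.exp (-((r - α * δ) * g.dist y y')) := by
  have hst := scaleTransfer_len_rpow hF 1 (by norm_num) y y'
  simp only [Real.rpow_one] at hst
  have hL1 : g.L ^ |(1 : ℝ)| ≤ L₀ := rpow_abs_le_L₀' hF 1 (by norm_num)
  have hy' := hlen y'
  -- e^{−αδd} len y' ≤ L₀ len y  ⇒  1 ≤ L₀ (len y / len y') e^{αδd}
  have h1 : Real.exp (-(α * δ * g.dist y y')) * g.len y' ≤ L₀ * g.len y :=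
    hst.trans (mul_le_mul_of_nonneg_right hL1 (hlen y).le)
  have hsplit : Real.exp (-(r * g.dist y y')) =
      Real.exp (-(α * δ * g.dist y y')) * Real.exp (-((r - α * δ) * g.dist y y')) := by
    rw [← Real.exp_add]; congr 1; ring
  have hE : 0 ≤ Real.exp (-((r - α * δ) * g.dist y y')) := Real.exp_nonneg _
  have h2 : Real.exp (-(α * δ * g.dist y y')) ≤ L₀ * (g.len y * (g.len y')⁻¹) := by
    have h := (le_div_iff₀ hy').mpr h1
    simpa only [div_eq_mul_inv, mul_assoc] using h
  calc S * Real.exp (-(r * g.dist y y'))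
      = S * (Real.exp (-(α * δ * g.dist y y')) * Real.exp (-((r - α * δ) * g.dist y y'))) := by rw [hsplit]
    _ ≤ S * (L₀ * (g.len y * (g.len y')⁻¹) * Real.exp (-((r - α * δ) * g.dist y y'))) :=
        mul_le_mul_of_nonneg_left (mul_le_mul_of_nonneg_right h2 hE) hS
    _ = S * L₀ * (g.len y * (g.len y')⁻¹) * Real.exp (-((r - α * δ) * g.dist y y')) := by ring

/-- **The transfer at γ = 1, swapped pair** (d symmetric): S·e^{−rd(y,y′)} ≦ S·L₀·((Lʲη)⁻¹·L^{j′}η)·e^{−(r − αδ)d(y,y′)}.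
[cite: Balaban1985BackgroundPropagators, p.398 remark after (3.47); Balaban1984PropagatorsII, Lemma 2.1 (2.60) p.234] -/
theorem const_le_ratio_transfer' {d : ℕ} {δ α L₀ : ℝ} (hF : Facts347 g R H d δ α L₀) (hlen : ∀ y : g.Site, 0 < g.len y)
    (hsymm : ∀ y y' : g.Site, g.dist y y' = g.dist y' y) {S r : ℝ} (hS : 0 ≤ S) (y y' : g.Site) :
    S * Real.exp (-(r * g.dist y y')) ≤
      S * L₀ * ((g.len y)⁻¹ * g.len y') * Real.exp (-((r - α * δ) * g.dist y y')) := by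
  have h := const_le_ratio_transfer hF hlen (S := S) (r := r) hS y' y
  rw [hsymm y' y] at h
  calc S * Real.exp (-(r * g.dist y y')) ≤ S * L₀ * (g.len y' * (g.len y)⁻¹) * Real.exp (-((r - α * δ) * g.dist y y')) := h
    _ = S * L₀ * ((g.len y)⁻¹ * g.len y') * Real.exp (-((r - α * δ) * g.dist y y')) := by ring

/-- n06-k's two-sided L² constant `twoConst` is ≧ 0 for nonnegative letters. [folklore] -/
private theorem twoConst_nonneg' {d₁ : ℕ} {δ₁ α₁ N2 B2 NF θ2 C L₀ : ℝ} (hN2 : 0 ≤ N2) (hB2 : 0 ≤ B2) (hNF : 0 ≤ NF) (hθ2 : 0 ≤ θ2)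
    (hC : 0 ≤ C) (hL₀ : 0 ≤ L₀) : 0 ≤ twoConst d₁ δ₁ α₁ N2 B2 NF θ2 C L₀ := by
  have := c1_nonneg d₁ δ₁ α₁
  unfold twoConst
  positivity

/-! ## §1 The Schur lines 0, 1, 2 (bundled and per direction) from the (3.42) sup majorants -/

section Schur

variable [Fintype X] [Fintype Y]

/-- **(3.46)₀ SYMMETRISED FROM (3.42)₁ BY THE SCHUR TEST**: a symmetric A₀ with the sup majorant C(Lʲη)²e^{−δd} has the L² block bound
‖1_{Δ(y)}A₀μ‖₂ ≦ C·Lʲη·L^{j′}η·e^{−δd(y,y′)}‖μ‖₂ (row bound at y × column bound at y′ under the square root; no scale transfer).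
[cite: Balaban1985BackgroundPropagators, (3.46) p.398 + (3.42) p.397 + Thm 3.11 p.416] -/
theorem blockBd_l0_of_sup {C δ : ℝ} (hC : 0 ≤ C) (hsymm : ∀ y y' : g.Site, g.dist y y' = g.dist y' y)
    (hlen : ∀ y : g.Site, 0 ≤ g.len y) (blk : X → g.Site) {A0 : Module.End ℝ (X → ℝ)}
    (h0 : HasMajorant (g := toB6 g R H) blk A0 (fun (a b : g.Site) => C * g.len a ^ 2 * Real.exp (-(δ * g.dist a b))))
    (hsym : IsTransposePair A0 A0) :
    BlockBd (g := toB6 g R H) blk blk A0 (fun (y y' : g.Site) => C * g.len y * g.len y' * Real.exp (-(δ * g.dist y y'))) := by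
  have hK : ∀ a b : g.Site, 0 ≤ C * g.len a ^ 2 * Real.exp (-(δ * g.dist a b)) := fun a b =>
    mul_nonneg (mul_nonneg hC (sq_nonneg _)) (Real.exp_nonneg _)
  have h0' : HasMajorantHom (g := toB6 g R H) blk blk A0 (fun (a b : g.Site) => C * g.len a ^ 2 * Real.exp (-(δ * g.dist a b))) :=
    (hasMajorantHom_iff (g := toB6 g R H) blk A0 _).mpr h0
  refine (blockBd_schur (G := toB6 g R H) blk blk hK hK h0' h0' hsym).mono fun y y' => ?_
  have hsq : (C * g.len y ^ 2 * Real.exp (-(δ * g.dist y y'))) * (C * g.len y' ^ 2 * Real.exp (-(δ * g.dist y' y))) =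
      (C * g.len y * g.len y' * Real.exp (-(δ * g.dist y y'))) ^ 2 := by
    rw [hsymm y' y]; ring
  have hnn : 0 ≤ C * g.len y * g.len y' * Real.exp (-(δ * g.dist y y')) :=
    mul_nonneg (mul_nonneg (mul_nonneg hC (hlen y)) (hlen y')) (Real.exp_nonneg _)
  show Real.sqrt ((C * g.len y ^ 2 * Real.exp (-(δ * g.dist y y'))) * (C * g.len y' ^ 2 * Real.exp (-(δ * g.dist y' y)))) ≤
    C * g.len y * g.len y' * Real.exp (-(δ * g.dist y y'))
  rw [hsq, Real.sqrt_sq hnn]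

/-- **(3.46)₁ AT THE INPUT SCALE FROM (3.42)₂,₃**: A₁ : 𝔩(X₁) → 𝔩(X₂) with sup majorant C·Lʲη·e^{−δd} whose transpose A₂ has the same majorant
has ‖1_{Δ(y)}A₁μ‖₂ ≦ C·L₀·L^{j′}η·e^{−(1−α)δd(y,y′)}‖μ‖₂ — n06-k's output-scale bound `blockBd_entry2` for A₂ read through the adjoint
(`B9SectDL2Decay.blockBd_of_adjoint`). [cite: Balaban1985BackgroundPropagators, (3.46) p.398 + (3.42) p.397 + p.398 remark after (3.47) + p.391] -/
theorem blockBd_l1_of_sup {X₁ X₂ : Type} [Fintype X₁] [Fintype X₂] {d : ℕ} {δ α L₀ C : ℝ} (hF : Facts347 g R H d δ α L₀)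
    (hC : 0 ≤ C) (hsymm : ∀ y y' : g.Site, g.dist y y' = g.dist y' y) (hlen : ∀ y : g.Site, 0 < g.len y)
    (blk₁ : X₁ → g.Site) (blk₂ : X₂ → g.Site) {A1 : (X₁ → ℝ) →ₗ[ℝ] (X₂ → ℝ)} {A2 : (X₂ → ℝ) →ₗ[ℝ] (X₁ → ℝ)}
    (h1 : HasMajorantHom (g := toB6 g R H) blk₁ blk₂ A1 (fun (a b : g.Site) => C * g.len a * Real.exp (-(δ * g.dist a b))))
    (h2 : HasMajorantHom (g := toB6 g R H) blk₂ blk₁ A2 (fun (a b : g.Site) => C * g.len a * Real.exp (-(δ * g.dist a b))))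
    (htr : IsTransposePair A1 A2) :
    BlockBd (g := toB6 g R H) blk₁ blk₂ A1
      (fun (y y' : g.Site) => C * L₀ * g.len y' * Real.exp (-((1 - α) * δ * g.dist y y'))) := by
  have h2' := blockBd_entry2 hF hC hsymm hlen blk₁ blk₂ h1 h2 htr
  have hL₀ : 0 ≤ L₀ := le_trans (le_trans zero_le_one hF.one_le_L) hF.L_le
  have hadj : ∀ (u : X₂ → ℝ) (v : X₁ → ℝ), u ⬝ᵥ A1 v = A2 u ⬝ᵥ v := fun u v => by
    rw [dotProduct_comm u (A1 v), dotProduct_comm (A2 u) v]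
    exact htr v u
  have h := blockBd_of_adjoint (g := toB6 g R H) (blk₁ := blk₁) (blk₂ := blk₂) (T := A1) (T' := A2) hadj h2'
    (fun y y' => mul_nonneg (mul_nonneg (mul_nonneg hC hL₀) (hlen y).le) (Real.exp_nonneg _))
  refine h.mono fun y y' => le_of_eq ?_
  show C * L₀ * g.len y' * Real.exp (-((1 - α) * δ * g.dist y' y)) = C * L₀ * g.len y' * Real.exp (-((1 - α) * δ * g.dist y y'))
  rw [hsymm y' y]

end Schur

/-! ## §2 The rows-20–21 L² schema from rows 18–19's material -/

section Assemble

variable [DecidableEq g.Site] [Fintype X] [DecidableEq X] [Fintype Y] [DecidableEq Y] [Fintype ι] [Fintype A]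

omit [DecidableEq Y] in
/-- ★★ **THEOREM 3.3 (3.46) FOR G₀ := G(U), THE ROWS-20–21 SCHEMA `Thm33G0L2M`, WITH THE BUNDLED TWO-SIDED LINE SUPPLIED** — from `Conv3107`
(the sum's (3.42) sup majorants at (C, δ)), the symmetry of G(U) and the transposes (∇_UG)ᵀ = G∇\*_U, (∇_{U,μ})ᵀ = ∇\*_{U,μ}, p. 398's
transfer (`Facts347` at (δ, α)), and n06-k's per-pair L² lines of the sum (`l2line3∕5_of_local310`: legs `L2SecondLegs310` + factors
`FactorsL2Second310`; `l2mixed_of_local310`: `L2MixedLegs310` + `FactorsL2Mixed310` + `DirSup310`; the fixed point (3.106) via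
`Identities310`; [4] Lemma 2.1 at the legs' rate δ₀); the bundled line ∇_UG₀∇\*_U is the hypothesis `hl4` (constant B₄, rate (1 − 2α)δ).
Output: one constant B₂ ≧ C·L₀, secondConst·L₀, mixedConst, B₄ and one rate ρ ≦ (1 − 3α)δ.  Nothing of print asserted.
[cite: Balaban1985BackgroundPropagators, Thm 3.10 (3.105)–(3.108) pp.414–416 + Thm 3.3 p.399 + (3.46) p.398 + (3.42) p.397 + (3.39) p.397 + p.398 remark after (3.47) + p.413 + p.391; Balaban1984PropagatorsII, (2.52)–(2.55) p.232 + Lemma 2.1 p.234] -/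
theorem thm33G0L2M_of_conv3107_l4 (𝔬 : B9Thm312Whole.Ops g B X Y Z W) (𝔬' : Ops310 g B X Y ι A) (𝔡 : DirOps310 𝔬' P)
    (d d₁ : ℕ) (δ α L₀ δ₀ α₁ ρ' N N' NF Cℓ N3 B3 θ3 NM BM θM C B₄ B₂ ρ : ℝ) (κ : Sizes310)
    (S3 SM : ι → Finset g.Site) (U : B.Cfg)
    -- the letter identifications (G₀ := G)
    (hblk : 𝔬.blk = 𝔬'.blk) (hblkY : 𝔬.blkY = 𝔬'.blkY) (hG0 : 𝔬.G0 U = 𝔬'.G U) (hD : 𝔬.D U = 𝔬'.D U)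
    (hDs : 𝔬.Dstar U = 𝔬'.Dstar U)
    -- numerics
    (hNF : 0 ≤ NF) (hN3 : 0 ≤ N3) (hB3 : 0 ≤ B3) (hθ3 : 0 ≤ θ3) (hNM : 0 ≤ NM) (hBM : 0 ≤ BM) (hθM : 0 ≤ θM)
    (hM : 1 ≤ g.M) (hC : 0 ≤ C) (hαδ : 0 ≤ α * δ) (hα2 : 2 * α * δ ≤ δ) (hα₁δ₀ : 0 ≤ α₁ * δ₀)
    (hrate : (1 - 2 * α) * δ ≤ (1 - α₁) * δ₀) (hB₄ : 0 ≤ B₄)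
    (hB1 : C * L₀ ≤ B₂) (hB3' : secondConst d₁ δ₀ α₁ N3 B3 NF θ3 C L₀ * L₀ ≤ B₂)
    (hBM' : mixedConst d₁ δ₀ α₁ NM BM NF θM C L₀ ≤ B₂) (hB4' : B₄ ≤ B₂) (hρ : ρ ≤ (1 - 3 * α) * δ)
    -- static data, member facts, Lemma 2.1
    (hs : StaticOK310 𝔬' ρ' N N' NF Cℓ κ)
    (hcnt3 : ∀ a : g.Site, (∑ i, if a ∈ S3 i then (1 : ℝ) else 0) ≤ N3)
    (hcntM : ∀ a : g.Site, (∑ i, if a ∈ SM i then (1 : ℝ) else 0) ≤ NM)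
    (h261 : Ineq261 d₁ (toB6 g R H) δ₀ α₁) (hF : Facts347 g R H d δ α L₀)
    -- rows 18–19's Theorem-3.10 schemas at U (n06-k), the symmetry ∕ transposition letters, the sum's (3.42) majorants
    (hi : Identities310 𝔬' R H U)
    (hL3 : L2SecondLegs310 𝔬' 𝔡 R H S3 B3 δ₀ U) (hF3 : FactorsL2Second310 𝔬' 𝔡 R H θ3 δ₀ U)
    (hLM : L2MixedLegs310 𝔬' 𝔡 R H SM BM δ₀ U) (hFM : FactorsL2Mixed310 𝔬' 𝔡 R H θM δ₀ U)
    (hDS : DirSup310 𝔬' 𝔡 R H U) (hDT : DirTranspose310 𝔬' 𝔡 U)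
    (hsym : IsTransposePair (𝔬'.G U) (𝔬'.G U)) (htr : IsTransposePair (𝔬'.D U ∘ₗ 𝔬'.G U) (𝔬'.G U ∘ₗ 𝔬'.Dstar U))
    (hc : Conv3107 𝔬' R H C δ U)
    (hl4 : BlockBd (g := toB6 g R H) 𝔬'.blkY 𝔬'.blkY (𝔬'.D U ∘ₗ (𝔬'.G U ∘ₗ 𝔬'.Dstar U))
      (fun (y y' : g.Site) => B₄ * Real.exp (-((1 - 2 * α) * δ * g.dist y y')))) :
    Thm33G0L2M 𝔬 𝔡.Dd 𝔡.Dsd R H B₂ ρ U := by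
  have hlen0 : ∀ y : g.Site, 0 ≤ g.len y := fun y => (hs.lenpos y).le
  have hL₀ : 0 ≤ L₀ := le_trans (le_trans zero_le_one hF.one_le_L) hF.L_le
  have hL₀1 : 1 ≤ L₀ := le_trans hF.one_le_L hF.L_le
  have hCB : C ≤ B₂ := le_trans (by nlinarith [hL₀1, hC]) hB1
  have hB₂ : 0 ≤ B₂ := le_trans hC hCB
  have hCL : 0 ≤ C * L₀ := mul_nonneg hC hL₀
  -- the rates: δ ≥ (1−α)δ ≥ (1−2α)δ ≥ (1−3α)δ ≥ ρ
  have hρ0 : ρ ≤ δ := by nlinarith [hρ, hαδ]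
  have hρ1 : ρ ≤ (1 - α) * δ := by nlinarith [hρ, hαδ]
  have hρ2 : ρ ≤ (1 - 2 * α) * δ := by nlinarith [hρ, hαδ]
  have hρ3 : ρ ≤ (1 - 2 * α) * δ - α * δ := by nlinarith [hρ, hαδ]
  have hexp : ∀ {r : ℝ}, ρ ≤ r → ∀ y y' : g.Site, Real.exp (-(r * g.dist y y')) ≤ Real.exp (-(ρ * g.dist y y')) :=
    fun hr y y' => Real.exp_le_exp.mpr (neg_le_neg (mul_le_mul_of_nonneg_right hr (hs.dnn y y')))
  -- the generic weakening (c ≤ B₂, w ≥ 0, r ≥ ρ)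
  have hweak : ∀ {c r : ℝ} (w : ℝ), 0 ≤ w → 0 ≤ c → c ≤ B₂ → ρ ≤ r → ∀ y y' : g.Site,
      c * w * Real.exp (-(r * g.dist y y')) ≤ B₂ * w * Real.exp (-(ρ * g.dist y y')) :=
    fun w hw hc0 hcB hr y y' => mul_le_mul (mul_le_mul_of_nonneg_right hcB hw) (hexp hr y y') (Real.exp_nonneg _)
      (mul_nonneg hB₂ hw)
  -- the per-direction transposes (∇_νG)ᵀ = G∇*_ν
  have htrd : ∀ ν : P, IsTransposePair (𝔡.Dd U ν ∘ₗ 𝔬'.G U) (𝔬'.G U ∘ₗ 𝔡.Dsd U ν) := fun ν => hsym.comp (hDT.tr ν).symm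
  -- n06-k's lines of the sum
  have hS0 := const_le_ratio_transfer hF hs.lenpos
    (S := secondConst d₁ δ₀ α₁ N3 B3 NF θ3 C L₀) (r := (1 - 2 * α) * δ) (secondConst_nonneg hN3 hB3 hNF hθ3 hC hL₀)
  have hS0' := const_le_ratio_transfer' hF hs.lenpos hs.symm
    (S := secondConst d₁ δ₀ α₁ N3 B3 NF θ3 C L₀) (r := (1 - 2 * α) * δ) (secondConst_nonneg hN3 hB3 hNF hθ3 hC hL₀)
  have hSK : 0 ≤ secondConst d₁ δ₀ α₁ N3 B3 NF θ3 C L₀ * L₀ := mul_nonneg (secondConst_nonneg hN3 hB3 hNF hθ3 hC hL₀) hL₀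
  refine
    { l0 := ?_
      l1 := ?_
      l2 := ?_
      l3 := fun q => ?_
      l4 := ?_
      l5 := fun q => ?_
      l1d := fun ν => ?_
      l2d := fun μ => ?_
      l4m := fun q => ?_ }
  · -- line 0: Schur, no transfer (rate δ)
    rw [hblk, hG0]
    refine (blockBd_l0_of_sup (R := R) (H := H) hC hs.symm hlen0 𝔬'.blk hc.1 hsym).mono fun y y' => ?_
    have h := hweak (g.len y * g.len y') (mul_nonneg (hlen0 y) (hlen0 y')) hC hCB hρ0 y y'
    calc C * g.len y * g.len y' * Real.exp (-(δ * g.dist y y'))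
        = C * (g.len y * g.len y') * Real.exp (-(δ * g.dist y y')) := by ring
      _ ≤ B₂ * (g.len y * g.len y') * Real.exp (-(ρ * g.dist y y')) := h
      _ = B₂ * g.len y * g.len y' * Real.exp (-(ρ * g.dist y y')) := by ring
  · -- line 1: ∇_UG₀ at the input scale
    rw [hblk, hblkY, hG0, hD]
    exact (blockBd_l1_of_sup hF hC hs.symm hs.lenpos 𝔬'.blk 𝔬'.blkY hc.2.1 hc.2.2.1 htr).mono fun y y' =>
      hweak (g.len y') (hlen0 y') hCL hB1 hρ1 y y'
  · -- line 2: G₀∇*_U at the output scale (n06-k's `blockBd_entry2` verbatim)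
    rw [hblk, hblkY, hG0, hDs]
    exact (blockBd_entry2 hF hC hs.symm hs.lenpos 𝔬'.blk 𝔬'.blkY hc.2.1 hc.2.2.1 htr).mono fun y y' =>
      hweak (g.len y) (hlen0 y) hCL hB1 hρ1 y y'
  · -- line 3: ∇_ν∇_μG₀ per pair, n06-k's line + the transfer at the swapped pair
    rw [hblk, hG0]
    have h3 := l2line3_of_local310 𝔬' 𝔡 R H d d₁ δ α L₀ δ₀ α₁ ρ' N N' NF Cℓ N3 B3 θ3 C κ S3 U hNF hN3 hB3 hθ3 hM hC hα2
      hα₁δ₀ hrate hs hcnt3 h261 hF hi hL3 hF3 hDT hc.1 hsym q.1 q.2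
    refine h3.mono fun y y' => (hS0' y y').trans ?_
    exact hweak ((g.len y)⁻¹ * g.len y') (mul_nonneg (inv_nonneg.mpr (hlen0 y)) (hlen0 y')) hSK hB3' hρ3 y y'
  · -- line 4 (bundled): supplied
    rw [hblkY, hG0, hD, hDs]
    refine hl4.mono fun y y' => ?_
    have h := hweak 1 zero_le_one hB₄ hB4' hρ2 y y'
    simpa only [mul_one] using h
  · -- line 5: G₀∇*_ν∇*_μ per pair, n06-k's line + the transfer at the direct pair
    rw [hblk, hG0]
    have h5 := l2line5_of_local310 𝔬' 𝔡 R H d d₁ δ α L₀ δ₀ α₁ ρ' N N' NF Cℓ N3 B3 θ3 C κ S3 U hNF hN3 hB3 hθ3 hM hC hα2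
      hα₁δ₀ hrate hs hcnt3 h261 hF hi hL3 hF3 hc.1 hsym q.1 q.2
    refine h5.mono fun y y' => (hS0 y y').trans ?_
    exact hweak (g.len y * (g.len y')⁻¹) (mul_nonneg (hlen0 y) (inv_nonneg.mpr (hlen0 y'))) hSK hB3' hρ3 y y'
  · -- ∇_{U,ν}G₀ at the input scale: Schur on the components (`DirSup310`) + adjoint
    rw [hblk, hG0]
    exact (blockBd_l1_of_sup hF hC hs.symm hs.lenpos 𝔬'.blk 𝔬'.blk (hDS.left _ hc.2.1 ν) (hDS.right _ hc.2.2.1 ν)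
      (htrd ν)).mono fun y y' => hweak (g.len y') (hlen0 y') hCL hB1 hρ1 y y'
  · -- G₀∇*_{U,μ} at the output scale
    rw [hblk, hG0]
    exact (blockBd_entry2 hF hC hs.symm hs.lenpos 𝔬'.blk 𝔬'.blk (hDS.left _ hc.2.1 μ) (hDS.right _ hc.2.2.1 μ)
      (htrd μ)).mono fun y y' => hweak (g.len y) (hlen0 y) hCL hB1 hρ1 y y'
  · -- the mixed pair line (n06-k's `l2mixed_of_local310` verbatim)
    rw [hblk, hG0]
    have hm := l2mixed_of_local310 𝔬' 𝔡 R H d d₁ δ α L₀ δ₀ α₁ ρ' N N' NF Cℓ NM BM θM C κ SM U hNF hNM hBM hθM hM hC hα2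
      hα₁δ₀ hrate hs hcntM h261 hF hi hLM hFM hDS hDT hc.2.1 hc.2.2.1 hsym q.1 q.2
    refine hm.mono fun y y' => ?_
    have h := hweak 1 zero_le_one (mixedConst_nonneg hNM hBM hNF hθM hC hL₀) hBM' hρ2 y y'
    simpa only [mul_one] using h

/-- ★★ **THE SAME WITH THE BUNDLED TWO-SIDED LINE FROM n06-k's ONE-SLOT LEGS** (`B9RWSums346Two.L2TwoLegs310 ∕ FactorsL2_310`, an EXISTING
schema species of rows 18–19's lineage, via `l2line4_of_local310`; constant `twoConst`): `Thm33G0L2M 𝔬 Dd Dsd R H B₂ ρ U` with no L² line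
of G₀ displayed at all. [cite: Balaban1985BackgroundPropagators, Thm 3.10 (3.105)–(3.108) pp.414–416 + Thm 3.3 p.399 + (3.46) p.398 + (3.42) p.397 + p.398 remark after (3.47) + p.413; Balaban1984PropagatorsII, (2.52)–(2.55) p.232 + Lemma 2.1 p.234] -/
theorem thm33G0L2M_of_conv3107 (𝔬 : B9Thm312Whole.Ops g B X Y Z W) (𝔬' : Ops310 g B X Y ι A) (𝔡 : DirOps310 𝔬' P)
    (d d₁ : ℕ) (δ α L₀ δ₀ α₁ ρ' N N' NF Cℓ N2 B2' θ2 N3 B3 θ3 NM BM θM C B₂ ρ : ℝ) (κ : Sizes310)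
    (S2 S3 SM : ι → Finset g.Site) (U : B.Cfg)
    (hblk : 𝔬.blk = 𝔬'.blk) (hblkY : 𝔬.blkY = 𝔬'.blkY) (hG0 : 𝔬.G0 U = 𝔬'.G U) (hD : 𝔬.D U = 𝔬'.D U)
    (hDs : 𝔬.Dstar U = 𝔬'.Dstar U)
    (hNF : 0 ≤ NF) (hN2 : 0 ≤ N2) (hB2' : 0 ≤ B2') (hθ2 : 0 ≤ θ2) (hN3 : 0 ≤ N3) (hB3 : 0 ≤ B3) (hθ3 : 0 ≤ θ3)
    (hNM : 0 ≤ NM) (hBM : 0 ≤ BM) (hθM : 0 ≤ θM)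
    (hM : 1 ≤ g.M) (hC : 0 ≤ C) (hαδ : 0 ≤ α * δ) (hα2 : 2 * α * δ ≤ δ) (hα₁δ₀ : 0 ≤ α₁ * δ₀)
    (hrate : (1 - 2 * α) * δ ≤ (1 - α₁) * δ₀)
    (hB1 : C * L₀ ≤ B₂) (hB3' : secondConst d₁ δ₀ α₁ N3 B3 NF θ3 C L₀ * L₀ ≤ B₂)
    (hBM' : mixedConst d₁ δ₀ α₁ NM BM NF θM C L₀ ≤ B₂) (hB4' : twoConst d₁ δ₀ α₁ N2 B2' NF θ2 C L₀ ≤ B₂)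
    (hρ : ρ ≤ (1 - 3 * α) * δ)
    (hs : StaticOK310 𝔬' ρ' N N' NF Cℓ κ)
    (hcnt2 : ∀ a : g.Site, (∑ i, if a ∈ S2 i then (1 : ℝ) else 0) ≤ N2)
    (hcnt3 : ∀ a : g.Site, (∑ i, if a ∈ S3 i then (1 : ℝ) else 0) ≤ N3)
    (hcntM : ∀ a : g.Site, (∑ i, if a ∈ SM i then (1 : ℝ) else 0) ≤ NM)
    (h261 : Ineq261 d₁ (toB6 g R H) δ₀ α₁) (hF : Facts347 g R H d δ α L₀)
    (hi : Identities310 𝔬' R H U)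
    (hL2 : L2TwoLegs310 𝔬' R H S2 B2' δ₀ U) (hF2 : FactorsL2_310 𝔬' R H θ2 δ₀ U)
    (hL3 : L2SecondLegs310 𝔬' 𝔡 R H S3 B3 δ₀ U) (hF3 : FactorsL2Second310 𝔬' 𝔡 R H θ3 δ₀ U)
    (hLM : L2MixedLegs310 𝔬' 𝔡 R H SM BM δ₀ U) (hFM : FactorsL2Mixed310 𝔬' 𝔡 R H θM δ₀ U)
    (hDS : DirSup310 𝔬' 𝔡 R H U) (hDT : DirTranspose310 𝔬' 𝔡 U)
    (hsym : IsTransposePair (𝔬'.G U) (𝔬'.G U)) (htr : IsTransposePair (𝔬'.D U ∘ₗ 𝔬'.G U) (𝔬'.G U ∘ₗ 𝔬'.Dstar U))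
    (hc : Conv3107 𝔬' R H C δ U) :
    Thm33G0L2M 𝔬 𝔡.Dd 𝔡.Dsd R H B₂ ρ U := by
  have hL₀ : 0 ≤ L₀ := le_trans (le_trans zero_le_one hF.one_le_L) hF.L_le
  have h4 := l2line4_of_local310 𝔬' R H d d₁ δ α L₀ δ₀ α₁ ρ' N N' NF Cℓ N2 B2' θ2 C κ S2 U hNF hN2 hB2' hθ2 hM hC hα2 hα₁δ₀
    hrate hs hcnt2 h261 hF hi hL2 hF2 hc.2.1 hc.2.2.1 htr
  exact thm33G0L2M_of_conv3107_l4 𝔬 𝔬' 𝔡 d d₁ δ α L₀ δ₀ α₁ ρ' N N' NF Cℓ N3 B3 θ3 NM BM θM C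
    (twoConst d₁ δ₀ α₁ N2 B2' NF θ2 C L₀) B₂ ρ κ S3 SM U hblk hblkY hG0 hD hDs hNF hN3 hB3 hθ3 hNM hBM hθM hM hC hαδ hα2
    hα₁δ₀ hrate (twoConst_nonneg' hN2 hB2' hNF hθ2 hC hL₀) hB1 hB3' hBM' hB4' hρ hs hcnt3 hcntM h261 hF hi hL3 hF3 hLM hFM hDS
    hDT hsym htr hc h4

end Assemble

end

end Literature.MathematicalPhysics.QuantumFieldTheory.Balaban1983to89.B9Thm312WholeFromThm310L2
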